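import Summits.AtomisticToContinuum.HydrodynamicLimit.Theorems.ImplosionDichotomyHydroLimitInBandSplit
import Summits.AtomisticToContinuum.HydrodynamicLimit.Theorems.ImplosionDichotomyHydroLimitInBandOfHeart
import Summits.AtomisticToContinuum.HydrodynamicLimit.Theses.AntiMazurCoboundaries
import Summits.AtomisticToContinuum.HydrodynamicLimit.Theses.TwoClocks
import HarnessLib

/-!
# The entropy clock from the kinetic instance's output to `RelEntropyVanishing`
# (registered stub `stub_clockFromInstance`, line `rare-band-ladder-dock`, crux `KineticWindowGronwall`, stmt-AtomisticToContinuum-9282)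

Support file (`--supports stmt-AtomisticToContinuum-9282`) for the registered stub `stub_clockFromInstance : ClockFromInstance` of the
skeleton `Cruxes/KineticWindowGronwall/Lines/rare_band_ladder_dock.lean` (v2). Plumbing over LANDED theorems, in three steps:
(1) `windowClauseInBand_of_instance` — the window clause of the shared one-window heart, `HydroLimitInBandHeart.stub_windowClause`
    (crux 9133, lead c3), consumes its eighth antecedent KCWU-along-families ONLY through the output of the landed kinetic instance KC1
    (`stub_kineticInstance hKC stub_loHeatFluxCutoffFamily`, its line 170); this line supplies that output directly (`KineticInstanceOut`,
    produced by the neighbour stub `stub_productKineticInstance`), so the clause is re-run with the hypothesis in place of line 170 (a COPY;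
    the analysis is the sibling leads', `ClampedCurrentsDockHeart.window_estimate` and the `OneFlightGossipEngineClampedCurrentsDock*` files);
(2) `gronwallCoreInBand_of_instance` — the landed static clause, v11 glue, ledger, window continuity (CAT, CEAT from `TransferActivityTails`
    by `activityTails_of_transferActivityTails`; ECT by name), a-priori bound and `gronwallCoreInBand_of_ledger` give the GUARDED core;
(3) `relEntropyVanishing_of_gronwallCoreInBand` — the landed in-band reduction `EntropyClockDock.relEntropyVanishingInBand_of_gronwallCoreInBand`
    gives the guarded Yau target and `DiluteSelfConsistency` at `η := η₀` discharges the guard for every tied classical solution.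
Worker of lead c3 of crux 9282 (prover-line-stmt-AtomisticToContinuum-9282-c3-0).
-/

noncomputable section

open MeasureTheory Filter Set Topology InformationTheory
open scoped ENNReal

namespace Summit.AtomisticToContinuum.HydrodynamicLimit.Theorems.KineticWindowGronwallClockFromInstance

open Literature.MathematicalPhysics.KineticTheory Literature.Analysis.FluidPDE Literature.Analysis.FunctionSpaces
open Summit.AtomisticToContinuum.HydrodynamicLimit.Theses
open Summit.AtomisticToContinuum.HydrodynamicLimit.Theorems
open Summit.AtomisticToContinuum.HydrodynamicLimit.Theses.TwoClocks (TransferActivityTails EnergyCurrentTails DiluteSelfConsistency)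
open Summit.AtomisticToContinuum.HydrodynamicLimit.Theses.AntiMazurCoboundaries (RelEntropyVanishing)
open Summit.AtomisticToContinuum.HydrodynamicLimit.Theorems.ClampedCurrentsDockPathwise (PathwiseEntropyProduction)
open Summit.AtomisticToContinuum.HydrodynamicLimit.Theorems.ClampedCurrentsDockCancellation (EulerCancellation)
open Summit.AtomisticToContinuum.HydrodynamicLimit.Theorems.ClampedCurrentsDockEos (EosConsistency)
open Summit.AtomisticToContinuum.HydrodynamicLimit.Theorems.ClampedCurrentsDockClampRemainder (TransferClampRemainder)
open Summit.AtomisticToContinuum.HydrodynamicLimit.Theorems.HydroLimitInBandOfHeart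
  (LocalClampedTransferWindowLDFamily CollisionEnergyActivityTails CoherentSuprathermalContentVanishesW GronwallCoreInBand
    gronwallCoreInBand_of_ledger)
open Summit.AtomisticToContinuum.HydrodynamicLimit.Theorems.HydroLimitInBandHeart (WindowClauseInBand exists_nat_mul_rpow_le guard_of_band)

/-! ## §1 The output of the kinetic instance (verbatim from the skeleton `Lines/rare_band_ladder_dock.lean` §1b) -/


/-- **THE OUTPUT OF THE LANDED KINETIC INSTANCE KC1** — VERBATIM the conclusion of
`Theorems.ClampedCurrentsDockKineticInstance.KineticInstance` (= `KineticCurrentsWindowLDFamily → LoHeatFluxCutoffFamily → THIS`, see the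
`rfl` example below): along every reference family `(a, θ, u)` continuous/smooth on the slab `[0,t₁] × 𝕋³` obeying the `ηK` packing guard,
for every suprathermal threshold `K⋆` there is a continuous bounded radial profile `G` equal to `s' − 5θ` below `K⋆²` such that the window
exponential moment of the traceless-thermal-stress + re-orthogonalised low heat-flux member `lo` is `≤ e^{ε(N+1)}` for `|β| ≤ β₀`,
`τ ≥ τ₀`, `N ≥ N₀`, uniformly in `s ∈ [0,t₁]`. This is the ONLY form in which the heart's window clause consumes its kinetic input. -/
def KineticInstanceOut : Prop :=
  ∃ ηK : ℝ, 0 < ηK ∧ ∀ (t₁ : ℝ) (a θ : ℝ → T3 → ℝ) (u : ℝ → T3 → V3), 0 ≤ t₁ →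
    ContinuousOn (Function.uncurry a) (Set.Icc 0 t₁ ×ˢ Set.univ) → (∀ s ∈ Set.Icc 0 t₁, ∀ x, 0 < a s x) →
    Torus.IsSmoothSpaceTimeOn (Set.Icc 0 t₁) θ → Torus.IsSmoothSpaceTimeOn (Set.Icc 0 t₁) u →
    (∀ s ∈ Set.Icc 0 t₁, ∀ x, 0 < θ s x) →
    ∀ σ : ℝ, 0 < σ → (∀ s ∈ Set.Icc 0 t₁, σ ^ 3 * (⨆ x, a s x) ≤ ηK * ∫ x, a s x) →
    ∀ Φ : (N : ℕ) → HardSphereFlow (Torus.geometry (Fin 3)) (hsDiameter σ N) (N + 1),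
    ∀ Kstar : ℝ, 0 < Kstar →
    ∃ G : ℝ → T3 × ℝ → ℝ, ContinuousOn (Function.uncurry G) (Set.Icc 0 t₁ ×ˢ Set.univ) ∧
      (∃ C : ℝ, ∀ s ∈ Set.Icc 0 t₁, ∀ y : T3 × ℝ, 0 ≤ y.2 → |G s y| ≤ C) ∧
      (∀ s ∈ Set.Icc 0 t₁, ∀ (x : T3) (s' : ℝ), s' ≤ Kstar ^ 2 → G s (x, s') = s' - 5 * θ s x) ∧
      ∃ β₀ : ℝ, 0 < β₀ ∧ ∀ β : ℝ, |β| ≤ β₀ → ∀ ε : ℝ, 0 < ε → ∃ τ₀ : ℝ, 0 < τ₀ ∧ ∀ τ : ℝ, τ₀ ≤ τ →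
      ∃ N₀ : ℕ, ∀ N : ℕ, N₀ ≤ N → ∀ s ∈ Set.Icc 0 t₁,
        (let lo := fun (s : ℝ) (y : T3 × V3) =>
           (θ s y.1)⁻¹ * ∑ j : Fin 3, ∑ k : Fin 3,
               ((y.2 - u s y.1) j * (y.2 - u s y.1) k - (if j = k then ‖y.2 - u s y.1‖ ^ 2 / 3 else 0)) *
                 Torus.partialDeriv k (fun x => u s x j) y.1 +
             (∑ k : Fin 3, Torus.partialDeriv k (θ s) y.1 / (2 * (θ s y.1) ^ 2) * (y.2 - u s y.1) k) *
               G s (y.1, ‖y.2 - u s y.1‖ ^ 2)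
         ∫⁻ z, ENNReal.ofReal (Real.exp (β * ∑ i : Fin (N + 1),
             (τ * ((N : ℝ) + 1) ^ (-(1 / 3 : ℝ)))⁻¹ *
               ∫ r in (0 : ℝ)..(τ * ((N : ℝ) + 1) ^ (-(1 / 3 : ℝ))), lo s ((Φ N).flow r z i)))
           ∂(localGibbsLaw σ (a s) (u s) (θ s) N (Φ N)) ≤
         ENNReal.ofReal (Real.exp (ε * ((N : ℝ) + 1))))

/-- Sanity: `KineticInstanceOut` IS the conclusion of the landed KC1 (`ClampedCurrentsDockKineticInstance.KineticInstance`). -/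
example : ClampedCurrentsDockKineticInstance.KineticInstance =
    (ClampedCurrentsDockKineticInstance.KineticCurrentsWindowLDFamily →
      ClampedCurrentsDockKineticInstance.LoHeatFluxCutoffFamily → KineticInstanceOut) := rfl

/-! ## §2 The window clause from the kinetic instance's output -/

/-- **The window clause of Yau's one-window entropy ledger, in band, from the OUTPUT of the kinetic instance** (step (1) of the
registered stub `stub_clockFromInstance` of stmt-9282): verbatim the landed `HydroLimitInBandHeart.stub_windowClause` with its eighth
antecedent KCWU-along-families replaced by `KineticInstanceOut` — thresholds `ηw` (EOS window, KC1/LC1 guards, statics, activity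
inversion), `σ₀` (QC-b, CC3, ECT, 1/2), `K = 5/β`, `β = min(β₀^{KC1}, β₀^{LC1})` fixed after `(t, V, K⋆)` and before `ε`, then
`ε ↦ (ε′, ε₁, ε₃, τ, N₀)`, and per window C0 + `window_estimate` + the a-priori bound for the running supremum.
[cite: Yau1991, §2; OllaVaradhanYau1993, §3] -/
theorem windowClauseInBand_of_instance :
    PathwiseEntropyProduction → EulerCancellation → EosConsistency → TransferClampRemainder →
      LocalClampedTransferWindowLDFamily → CollisionEnergyActivityTails → CoherentSuprathermalContentVanishesW →
      KineticInstanceOut → OneFlightGossipEngine.CollisionActivityTails → OneFlightGossipEngine.EnergyCurrentTails →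
      WindowClauseInBand := by
  -- adapted from `HydroLimitInBandHeart.stub_windowClause` (Theorems/ImplosionDichotomyHydroLimitInBandWindowClause.lean, landed):
  -- the only change is that KC1's output is a hypothesis (`hKI`) instead of `stub_kineticInstance hKC stub_loHeatFluxCutoffFamily`
  intro _hS2 _hS8 _hS4 _hS10 hLC hCEAT hCSCV hKI hCAT hECT r Rf hr hana hLip hsol hbd hcont huniq η₀ hη₀ _HU
  obtain ⟨η₁, hη₁, hη₁r, F, hF, hZF, hRfF⟩ := ClampedCurrentsDockHeart.eosBridge hr hsol hbd hcont huniq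
  obtain ⟨ηK, hηK, HK⟩ := hKI
  obtain ⟨ηC, hηC, HC⟩ := ClampedCurrentsDockLocalInstance.stub_localCollisionalInstance hLC
  obtain ⟨ηs, hηs, HS⟩ := ClampedCurrentsDockStaticLimit.stub_staticLimit r Rf hr hana hLip hsol hbd hcont huniq
  set ηA : ℝ := min (r / (2 * (2 * (2 * Real.exp 1 + 1)))) (1 / (64 * Real.exp 1 * v₁)) with hηA
  have hηA0 : 0 < ηA := by
    have := v₁_pos
    have := Real.exp_pos 1
    positivity
  set ηw : ℝ := min (min (η₁ / 2) (min (ηK / 2) (ηC / 2))) (min ηs ηA) with hηw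
  have hηw0 : 0 < ηw := by positivity
  have hηw1 : ηw ≤ η₁ / 2 := (min_le_left _ _).trans (min_le_left _ _)
  have hηwK : ηw ≤ ηK / 2 := (min_le_left _ _).trans ((min_le_right _ _).trans (min_le_left _ _))
  have hηwC : ηw ≤ ηC / 2 := (min_le_left _ _).trans ((min_le_right _ _).trans (min_le_right _ _))
  have hηws : ηw ≤ ηs := (min_le_right _ _).trans (min_le_left _ _)
  have hηwA : ηw ≤ ηA := (min_le_right _ _).trans (min_le_right _ _)
  have hηwr : ηw ≤ r := by
    have : ηA ≤ r / (2 * (2 * (2 * Real.exp 1 + 1))) := min_le_left _ _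
    have h2 : r / (2 * (2 * (2 * Real.exp 1 + 1))) ≤ r := by
      rw [div_le_iff₀ (by positivity)]
      have := Real.exp_pos 1
      nlinarith
    linarith
  refine ⟨ηw, hηw0, fun a₀ θ₀ u₀ ha hθ hu ha0 hθ0 => ?_⟩
  obtain ⟨σQ, hσQ, HQ⟩ := ClampedCurrentsDockCubicChannel.stub_cubicChannel
    ClampedCurrentsDockCubicPathwise.stub_cubicChannelPathwise ClampedCurrentsDockThirdMoment.stub_thirdMomentWindow
    ClampedCurrentsDockFlowShiftFreeze.windowFlowShift hCSCV hECT a₀ θ₀ u₀ ha hθ hu ha0 hθ0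
  obtain ⟨σT, hσT, HT⟩ := ClampedCurrentsDockTransferTails.stub_transferActivityTails hCAT hCEAT a₀ θ₀ u₀ ha hθ hu ha0 hθ0
  obtain ⟨σE, hσE, HE⟩ := hECT a₀ θ₀ u₀ ha hθ hu ha0 hθ0
  refine ⟨min (min σQ σT) (min σE (1 / 2)), lt_min (lt_min hσQ hσT) (lt_min hσE (by norm_num)),
    fun σ hσ hσlt T ρ θ u hE hguard Φ htie t ht => ?_⟩
  have hσQ' : σ < σQ := hσlt.trans_le ((min_le_left _ _).trans (min_le_left _ _))
  have hσT' : σ < σT := hσlt.trans_le ((min_le_left _ _).trans (min_le_right _ _))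
  have hσE' : σ < σE := hσlt.trans_le ((min_le_right _ _).trans (min_le_left _ _))
  have hσ2 : σ < 1 / 2 := hσlt.trans_le ((min_le_right _ _).trans (min_le_right _ _))
  have hσ3 : 0 < σ ^ 3 := pow_pos hσ 3
  have hT : 0 < T := ht.1.trans ht.2
  have htI : t ∈ Ico 0 T := ⟨ht.1.le, ht.2⟩
  have hIt : Icc 0 t ⊆ Ico 0 T := fun s hs => ⟨hs.1, hs.2.trans_lt ht.2⟩
  have hmass : ∀ s ∈ Ico 0 T, ∫ x, ρ s x = 1 := fun s hs =>
    (DenseExcursionEverywhere.integral_density_eq hE hs).trans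
      (DenseExcursionEverywhere.integral_density_zero_eq_one hσ2.le ha hθ hu ha0 hθ0 Φ htie)
  have hgs : ∀ s ∈ Ico 0 T, ∀ x, ρ s x * σ ^ 3 < ηs := fun s hs x => (hguard s hs x).trans_le hηws
  have hg1 : ∀ s ∈ Ico 0 T, ∀ x, ρ s x * σ ^ 3 ∈ Ioo 0 η₁ := fun s hs x =>
    ⟨mul_pos (hE.density_pos s hs x) hσ3, (hguard s hs x).trans_le (hηw1.trans (by linarith))⟩
  have hg12 : ∀ s ∈ Icc 0 t, ∀ x, ρ s x * σ ^ 3 < η₁ / 2 := fun s hs x => (hguard s (hIt hs) x).trans_le hηw1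
  have hgr : ∀ s ∈ Icc 0 t, ∀ x, ρ s x * σ ^ 3 < r := fun s hs x => (hguard s (hIt hs) x).trans_le hηwr
  -- the explicit reference family: smooth and positive on `[0,T)` (SC-b)
  obtain ⟨hasm, hapos, -, -, -, -⟩ := HS σ hσ hσ2 T ρ θ u hE hgs hmass Φ t ht
  have hasm' : Torus.IsSmoothSpaceTimeOn (Ico 0 T) (fun s x => ρ s x * Rf (σ ^ 3 * ρ s x)) := hasm
  have hapos' : ∀ s ∈ Ico 0 T, ∀ x, 0 < (fun s x => ρ s x * Rf (σ ^ 3 * ρ s x)) s x := hapos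
  have hac : ∀ s ∈ Ico 0 T, Continuous fun x => ρ s x * Rf (σ ^ 3 * ρ s x) := fun s hs =>
    (hasm'.isSmooth_slice hs).continuous
  have hρc : ∀ s ∈ Ico 0 T, Continuous (ρ s) := fun s hs => (hE.smooth_density.isSmooth_slice hs).continuous
  -- the guards of KC1 / LC1 along the family
  have hguardX : ∀ {ηX : ℝ}, 2 * ηw ≤ ηX → ∀ s ∈ Icc 0 t,
      σ ^ 3 * (⨆ x, ρ s x * Rf (σ ^ 3 * ρ s x)) ≤ ηX * ∫ x, ρ s x * Rf (σ ^ 3 * ρ s x) :=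
    fun hX s hs => guard_of_band hbd hηwr hX hσ (hρc s (hIt hs)) (hE.density_pos s (hIt hs)) (hmass s (hIt hs))
      (hguard s (hIt hs)) (hac s (hIt hs))
  have hguardK : ∀ s ∈ Icc 0 t, σ ^ 3 * (⨆ x, (fun s x => ρ s x * Rf (σ ^ 3 * ρ s x)) s x) ≤
      ηK * ∫ x, (fun s x => ρ s x * Rf (σ ^ 3 * ρ s x)) s x := hguardX (by linarith)
  have hguardC : ∀ s ∈ Icc 0 t, σ ^ 3 * (⨆ x, ρ s x * Rf (σ ^ 3 * ρ s x)) ≤ ηC * ∫ x, ρ s x * Rf (σ ^ 3 * ρ s x) :=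
    hguardX (by linarith)
  -- the cubic channel: the suprathermal level `K⋆`
  obtain ⟨Kstar, hKstar, HQK⟩ := HQ σ hσ hσQ' T ρ θ u hE Φ htie t htI
  -- KC1 along the solution on the slab `[0,t]`
  have hθsmI : Torus.IsSmoothSpaceTimeOn (Icc 0 t) θ := hE.smooth_temperature.mono hIt
  have husmI : Torus.IsSmoothSpaceTimeOn (Icc 0 t) u := hE.smooth_velocity.mono hIt
  have haconI : ContinuousOn (Function.uncurry fun s x => ρ s x * Rf (σ ^ 3 * ρ s x)) (Icc 0 t ×ˢ univ) :=
    (ClampedCurrentsDockHeart.continuousOn_uncurry_of_isSmoothSpaceTimeOn hasm').mono (prod_mono hIt subset_rfl)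
  obtain ⟨G, hGc, ⟨CG, hCG⟩, hGagree, β₀K, hβ₀K, HKβ⟩ := HK t (fun s x => ρ s x * Rf (σ ^ 3 * ρ s x)) θ u ht.1.le haconI
    (fun s hs => hapos' s (hIt hs)) hθsmI husmI (fun s hs => hE.temperature_pos s (hIt hs)) σ hσ hguardK Φ Kstar hKstar
  set CG' : ℝ := max CG 0 with hCG'
  have hCG'0 : 0 ≤ CG' := le_max_right _ _
  have hCG'b : ∀ s ∈ Icc 0 t, ∀ y : T3 × ℝ, 0 ≤ y.2 → |G s y| ≤ CG' := fun s hs y hy => (hCG s hs y hy).trans (le_max_left _ _)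
  -- LC1 along the CLAMPED families (globally continuous), read on the slab
  set cl : ℝ → ℝ := ClampedCurrentsDockHeart.clampTime t with hcl_def
  have hclm : ∀ s, cl s ∈ Icc 0 t := fun s => ClampedCurrentsDockHeart.clampTime_mem ht.1.le s
  have hclI : ∀ s, cl s ∈ Ico 0 T := fun s => hIt (hclm s)
  set ac : ℝ → T3 → ℝ := fun s x => ρ (cl s) x * Rf (σ ^ 3 * ρ (cl s) x) with hac_def
  set θc : ℝ → T3 → ℝ := fun s => θ (cl s) with hθc_def
  set uc : ℝ → T3 → V3 := fun s => u (cl s) with huc_def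
  have hacc : ∀ s, Continuous (ac s) := fun s => hac _ (hclI s)
  have hac0 : ∀ s x, 0 < ac s x := fun s x => hapos' _ (hclI s) x
  have hθc0 : ∀ s x, 0 < θc s x := fun s x => hE.temperature_pos _ (hclI s) x
  have hacu : Continuous (Function.uncurry ac) := ClampedCurrentsDockHeart.continuous_uncurry_clamp ht.1.le haconI
  have hθcu : Continuous (Function.uncurry θc) :=
    ClampedCurrentsDockHeart.continuous_uncurry_clamp ht.1.le
      ((ClampedCurrentsDockHeart.continuousOn_uncurry_of_isSmoothSpaceTimeOn hE.smooth_temperature).mono (prod_mono hIt subset_rfl))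
  have hucu : Continuous (Function.uncurry uc) :=
    ClampedCurrentsDockHeart.continuous_uncurry_clamp ht.1.le
      ((ClampedCurrentsDockHeart.continuousOn_uncurry_of_isSmoothSpaceTimeOn hE.smooth_velocity).mono (prod_mono hIt subset_rfl))
  have hcl_id : ∀ s ∈ Icc 0 t, cl s = s := fun s hs => ClampedCurrentsDockHeart.clampTime_of_mem hs
  have hθcsm : Torus.IsSmoothSpaceTimeOn (Icc 0 t) θc :=
    ClampedCurrentsDockHeart.isSmoothSpaceTimeOn_congr hθsmI fun s hs => by simp only [hθc_def, hcl_id s hs]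
  have hucsm : Torus.IsSmoothSpaceTimeOn (Icc 0 t) uc :=
    ClampedCurrentsDockHeart.isSmoothSpaceTimeOn_congr husmI fun s hs => by simp only [huc_def, hcl_id s hs]
  have hguardCc : ∀ s ∈ Icc 0 t, σ ^ 3 * (⨆ x, ac s x) ≤ ηC * ∫ x, ac s x := fun s hs => by
    simp only [hac_def, hcl_id s hs]
    exact hguardC s hs
  obtain ⟨V₀C, _hV₀C, HCV⟩ := HC t ac θc uc hacc hacu hθcu hucu hac0 hθc0 hθcsm hucsm σ hσ hσ2 hguardCc Φ
  -- CC3: transfer-activity tails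
  obtain ⟨V₀T, hV₀T, HTV⟩ := HT σ hσ hσT' T ρ θ u hE Φ htie t htI
  set V : ℝ := max V₀C V₀T with hV
  have hV0 : 0 ≤ V := hV₀T.le.trans (le_max_right _ _)
  obtain ⟨β₀C, hβ₀C, HCβ⟩ := HCV V (le_max_left _ _)
  -- the tilt, fixed before `ε`
  set β : ℝ := min β₀K β₀C with hβ
  have hβ0 : 0 < β := lt_min hβ₀K hβ₀C
  have hβK : |(-β)| ≤ β₀K := by rw [abs_neg, abs_of_pos hβ0]; exact min_le_left _ _
  have hβC : |(-β)| ≤ β₀C := by rw [abs_neg, abs_of_pos hβ0]; exact min_le_right _ _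
  -- FZ: the freeze constant (also the common Lipschitz constant of the test functions)
  obtain ⟨Cfz, hCfz0, HFZ⟩ := ClampedCurrentsDockFlowShiftFreeze.freezeBounds σ T ρ θ u η₁ F hE hσ hη₁ hF hZF t ht hg12
  -- ECT at accuracy one: the third-moment level
  obtain ⟨M₃, N₀E, HEN⟩ := HE σ hσ hσE' T ρ θ u hE Φ htie t htI 1 one_pos
  -- the Gronwall rate
  refine ⟨5 / β, by positivity, fun ε hε => ?_⟩
  set ε' : ℝ := min ε 1 with hε'
  have hε'0 : 0 < ε' := lt_min hε one_pos
  have hε'1 : ε' ≤ 1 := min_le_right _ _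
  have hε'ε : ε' ≤ ε := min_le_left _ _
  set ε₁ : ℝ := β * ε' / 10 with hε₁
  have hε₁0 : 0 < ε₁ := by positivity
  set ε₃ : ℝ := ε' / (40 * (Cfz + 1)) with hε₃
  have hε₃0 : 0 < ε₃ := by positivity
  -- the window parameter `τ`
  obtain ⟨τK, hτK, HKτ⟩ := HKβ (-β) hβK ε₁ hε₁0
  obtain ⟨τC, hτC, HCτ⟩ := HCβ (-β) hβC (ε₁ / 4) (by positivity)
  obtain ⟨τQ, hτQ, HQτ⟩ := HQK G CG' hCG'0 hGc hCG'b hGagree (ε' / 10) (by positivity)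
  obtain ⟨τT, hτT, HTτ⟩ := HTV V (le_max_right _ _) ε₃ hε₃0
  set τ : ℝ := max (max τK τC) (max τQ τT) with hτ_def
  have hτ0 : 0 < τ := hτK.trans_le ((le_max_left _ _).trans (le_max_left _ _))
  obtain ⟨NK, HKN⟩ := HKτ τ ((le_max_left _ _).trans (le_max_left _ _))
  obtain ⟨NC, HCN⟩ := HCτ τ ((le_max_right _ _).trans (le_max_left _ _))
  obtain ⟨NQ, HQN⟩ := HQτ τ ((le_max_left _ _).trans (le_max_right _ _))
  obtain ⟨NT, HTN⟩ := HTτ τ ((le_max_right _ _).trans (le_max_right _ _))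
  -- `N` large enough for the freeze errors
  obtain ⟨Nsm, Hsm⟩ := exists_nat_mul_rpow_le (A := Cfz * τ * (40 * (2 * (max M₃ 0) ^ 3 + 6 + V))) hε'0
  refine ⟨τ, hτ0, max (max (max NK NC) (max NQ NT)) (max N₀E Nsm), fun N hN s hs0 hsw => ?_⟩
  simp only [max_le_iff] at hN
  obtain ⟨⟨⟨hNK, hNC⟩, hNQ, hNT⟩, hNE, hNsm⟩ := hN
  -- the window
  set w : ℝ := τ * ((N : ℝ) + 1) ^ (-(1 / 3 : ℝ)) with hw_def
  have hw0 : 0 < w := mul_pos hτ0 (Real.rpow_pos_of_pos (by positivity) _)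
  have hsw' : s ≤ s + w := le_add_of_nonneg_right hw0.le
  have hsI : s ∈ Icc 0 t := ⟨hs0, hsw'.trans hsw⟩
  have hsT : s ∈ Ico 0 T := hIt hsI
  have hswT : s + w < T := hsw.trans_lt ht.2
  have hρsc : Continuous (ρ s) := hρc s hsT
  have hρs0 : ∀ x, 0 < ρ s x := hE.density_pos s hsT
  -- C0: the one-window balance (identity + integrability)
  obtain ⟨hStrI, hColI, hbal⟩ := ClampedCurrentsDockWindowBalance.stub_windowBalance σ T N (Φ N) a₀ θ₀ u₀
    (fun s x => ρ s x * Rf (σ ^ 3 * ρ s x)) θ u hσ hσ2 ha hθ hu ha0 hθ0 hasm' hE.smooth_temperature hE.smooth_velocity hapos'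
    hE.temperature_pos s w hs0 hw0.le hswT
  -- KC1 at `(N, s)`
  have hKs := HKN N hNK s hsI
  -- LC1 at `(N, s)`: read at the solution's fields and at `ρ₀ = ρ_s` (activity inversion)
  have hcls : cl s = s := hcl_id s hsI
  have hpackA : σ ^ 3 * (⨆ x, ρ s x) ≤ min (r / (2 * (2 * (2 * Real.exp 1 + 1)))) (1 / (64 * Real.exp 1 * v₁)) := by
    have hbdd : BddAbove (Set.range (ρ s)) := (isCompact_range hρsc).bddAbove
    obtain ⟨xM, -, hxM⟩ := isCompact_univ.exists_isMaxOn univ_nonempty hρsc.continuousOn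
    have hsup : (⨆ x, ρ s x) = ρ s xM :=
      le_antisymm (ciSup_le fun x => (isMaxOn_iff.mp hxM) x (mem_univ x)) (le_ciSup hbdd xM)
    rw [hsup, mul_comm]
    exact ((hguard s hsT xM).trans_le hηwA).le
  have key : ∀ (f : T3 → ℝ) (hf : Continuous f) (hf0 : ∀ x, 0 < f x), f = (fun x => ρ s x * Rf (σ ^ 3 * ρ s x)) →
      rhoLim (profileOf f hf hf0) σ = ρ s := by
    rintro f hf hf0 rfl
    obtain ⟨_, _, -, -, h⟩ := EntropyClockDock.activity_of_density hr hsol hbd hcont huniq hσ hσ2 hρsc hρs0 (hmass s hsT) hpackA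
    exact h
  have hρ₀ : rhoLim (profileOf (ac s) (hacc s) (hac0 s)) σ = ρ s :=
    key (ac s) (hacc s) (hac0 s) (by simp only [hac_def, hcls])
  obtain ⟨hCm', hCe'⟩ := HCN N hNC s hsI
  have hCm := fun k : Fin 3 => hCm' k
  have hCe := hCe'
  simp only [hρ₀] at hCm hCe
  simp only [hac_def, hθc_def, huc_def, hcls] at hCm hCe
  -- CC3 at `(N, s)`, QC-b at `(N, s)`, ECT on the window
  have hTs := HTN N hNT s hsI
  have hQs := HQN N hNQ s hs0 hsw
  have HEN' : ∀ r' ∈ Icc s (s + w), ∫⁻ z, ENNReal.ofReal (((N : ℝ) + 1)⁻¹ * ∑ i : Fin (N + 1),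
      Set.indicator {v : V3 | M₃ < ‖v‖} (fun v => ‖v‖ ^ 3) (((Φ N).flow r' z i).2)) ∂(localGibbsLaw σ a₀ u₀ θ₀ N (Φ N)) ≤
      ENNReal.ofReal 1 := fun r' hr' => HEN N hNE r' ⟨hs0.trans hr'.1, hr'.2.trans hsw⟩
  -- Lipschitz constants of the test functions at `s`, continuity and bound of the cut-off profile at `s`
  have hLipm : ∀ (k : Fin 3) (x y : T3), |u s x k / θ s x - u s y k / θ s y| ≤ Cfz * Torus.euclidDist x y :=
    fun k x y => ((HFZ s hsI s hsI x 0).2.2.2.2.1) k y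
  have hLipe : ∀ x y : T3, |(-(θ s x)⁻¹) - (-(θ s y)⁻¹)| ≤ Cfz * Torus.euclidDist x y :=
    fun x y => ((HFZ s hsI s hsI x 0).2.2.2.2.2) y
  have hGs : Continuous (G s) :=
    hGc.comp_continuous (continuous_const.prodMk continuous_id) fun y => ⟨hsI, mem_univ _⟩
  have hCGs : ∀ y : T3 × ℝ, 0 ≤ y.2 → |G s y| ≤ CG' := fun y hy => hCG'b s hsI y hy
  have hsmall : Cfz * w * (40 * (2 * (max M₃ 0) ^ 3 + 6 + V)) ≤ ε' := by
    have := Hsm N hNsm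
    calc Cfz * w * (40 * (2 * (max M₃ 0) ^ 3 + 6 + V))
        = Cfz * τ * (40 * (2 * (max M₃ 0) ^ 3 + 6 + V)) * ((N : ℝ) + 1) ^ (-(1 / 3 : ℝ)) := by rw [hw_def]; ring
      _ ≤ ε' := this
  -- THE ONE-WINDOW ESTIMATE (the sibling's `window_estimate`; all implicit arguments given explicitly — the unifier must not
  -- solve metavariables through the window functionals)
  have hWE := @ClampedCurrentsDockHeart.window_estimate σ T η₁ τ t s w V Cfz Cfz CG' β ε' ε₁ ε₃ M₃ N (Φ N) ρ θ u F Rf G a₀ θ₀ u₀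
    ha hθ hu ha0 hθ0 hE hσ hσ2 hη₁ hF hZF hRfF hg1 hasm' hapos' ht hs0 hw0 hsw hτ0 hw_def hV0 hCfz0 hCfz0 hLipm hLipe hGs hCGs HFZ
    hβ0 hε'0 hε'1 hε₁ hε₃ hsmall hKs hCm hCe hTs hQs HEN' hStrI hColI
  -- the a-priori bound: the running supremum is a supremum
  obtain ⟨B, hB⟩ := EntropyClockDock.ledgerAprioriBound r Rf hr hbd hcont a₀ θ₀ u₀ ha hθ hu ha0 hθ0 σ hσ hσ2 T ρ θ u hE t ht hgr
    N (Φ N)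
  have hswI : Icc 0 (s + w) ⊆ Icc 0 t := Icc_subset_Icc_right hsw
  have hbdd : BddAbove ((fun s' => (klDiv ((Φ N).lawAt (localGibbsLaw σ a₀ u₀ θ₀ N (Φ N)) s')
      (localGibbsLaw σ (fun x => ρ s' x * Rf (σ ^ 3 * ρ s' x)) (u s') (θ s') N (Φ N))).toReal) '' Icc 0 (s + w)) := by
    refine ⟨max B 0, ?_⟩
    rintro _ ⟨s', hs', rfl⟩
    exact ENNReal.toReal_le_of_le_ofReal (le_max_right _ _)
      ((hB s' (hswI hs')).trans (ENNReal.ofReal_le_ofReal (le_max_left _ _)))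
  have hHs_le : (klDiv ((Φ N).lawAt (localGibbsLaw σ a₀ u₀ θ₀ N (Φ N)) s)
      (localGibbsLaw σ (fun x => ρ s x * Rf (σ ^ 3 * ρ s x)) (u s) (θ s) N (Φ N))).toReal ≤
      sSup ((fun s' => (klDiv ((Φ N).lawAt (localGibbsLaw σ a₀ u₀ θ₀ N (Φ N)) s')
        (localGibbsLaw σ (fun x => ρ s' x * Rf (σ ^ 3 * ρ s' x)) (u s') (θ s') N (Φ N))).toReal) '' Icc 0 (s + w)) :=
    le_csSup hbdd ⟨s, ⟨hs0, hsw'⟩, rfl⟩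
  have hK0 : 0 ≤ 5 / β * w := by positivity
  have h1 := mul_le_mul_of_nonneg_left hHs_le hK0
  have hwN : 0 ≤ w * ((N : ℝ) + 1) := by positivity
  have h2 : w * ((N : ℝ) + 1) * ε' ≤ w * ((N : ℝ) + 1) * ε := mul_le_mul_of_nonneg_left hε'ε hwN
  linarith [hbal, hWE, h1, h2]

/-! ## §3 The registered statement (verbatim from the skeleton §1b) -/

/-- **THE CLOCK FROM THE KINETIC INSTANCE** to `RelEntropyVanishing` verbatim. Proof plan: (1) a copy of the landed
`HydroLimitInBandHeart.stub_windowClause` (399 lines) with its 8th antecedent `KineticCurrentsWindowLDFamily` replaced by `KineticInstanceOut`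
(the original consumes KCWU only through `stub_kineticInstance hKC stub_loHeatFluxCutoffFamily`, line 170) ⟹ `WindowClauseInBand`; (2)
`HydroLimitInBandSplit.oneWindowLedgerStatic_of_clauses stub_staticClause`, `ClampedCurrentsDockFromWindows.stub_ledgerFromWindowsS`,
`ClampedCurrentsDockWindowContinuity.stub_windowContinuity` (CAT, CEAT from `TransferActivityTails` by
`HydroLimitInBandHeart.activityTails_of_transferActivityTails`; ECT by name), `EntropyClockDock.ledgerAprioriBound`,
`HydroLimitInBandOfHeart.gronwallCoreInBand_of_ledger` ⟹ `GronwallCoreInBand` (guard `ρσ³ < η_c`); (3) UNGUARD: a copy of the landed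
`EntropyClockDock.relEntropyDock_of_core` / `relEntropyDock_of_gronwallRf` (TwoClocksClampedWindowDock{TimeZero,Gronwall}) with the two idle
antecedents `KineticWindowLDUniform`, `ClampedTransferWindowLD` deleted (they are only threaded into `core`), the guard discharged inside
`core` by `DiluteSelfConsistency` at `η := η_c`, statics by `uniformLocalGibbsConcentration_proof`, `hsEosLowDensity_proof`. -/
def ClockFromInstance : Prop :=
  KineticInstanceOut → LocalClampedTransferWindowLDFamily → CoherentSuprathermalContentVanishesW →
    TransferActivityTails → EnergyCurrentTails → DiluteSelfConsistency → RelEntropyVanishing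

/-- Sanity: the target is the shared item 0766 in either spelling (same term). -/
example : RelEntropyVanishing = TwoClocks.RelEntropyVanishing := rfl

/-! ## §4 The guarded Grönwall core from the kinetic instance's output and the shared inputs -/

/-- **Step (2): `GronwallCoreInBand` from KC1's output and the heart's other inputs** — mirror of the landed
`HydroLimitInBandOfHeart.gronwallCoreInBand_of_heart` with the window clause of file 1 in place of `stub_windowClause`: the transfer-activity
tails split into CAT ∧ CEAT (`HydroLimitInBandHeart.activityTails_of_transferActivityTails`; `TwoClocks.TransferActivityTails` and the dock's
spelling are the same term), ECT is the OneFlightGossipEngine board item (same term as `TwoClocks.EnergyCurrentTails`), the four pathwise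
antecedents S2/S8/S4/S10 are landed, and the static clause, the v11 glue, the ledger, the window continuity, the a-priori bound and
`gronwallCoreInBand_of_ledger` are landed. [cite: Yau1991, §2] -/
theorem gronwallCoreInBand_of_instance (hKI : KineticInstanceOut) (hL : LocalClampedTransferWindowLDFamily)
    (hC : CoherentSuprathermalContentVanishesW) (hT : TransferActivityTails) (hE : EnergyCurrentTails) : GronwallCoreInBand :=
  -- adapted from `HydroLimitInBandOfHeart.gronwallCoreInBand_of_heart` (Theorems/ImplosionDichotomyHydroLimitInBandOfHeart.lean, landed)
  have hA := HydroLimitInBandHeart.activityTails_of_transferActivityTails hT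
  have hE' : OneFlightGossipEngine.EnergyCurrentTails := hE
  gronwallCoreInBand_of_ledger EntropyClockDock.ledgerAprioriBound
    (ClampedCurrentsDockFromWindows.stub_ledgerFromWindowsS
      (HydroLimitInBandSplit.oneWindowLedgerStatic_of_clauses HydroLimitInBandHeart.stub_staticClause
        (windowClauseInBand_of_instance ClampedCurrentsDockPathwise.stub_pathwise ClampedCurrentsDockCancellation.stub_cancellation
          ClampedCurrentsDockEos.stub_eos ClampedCurrentsDockClampRemainder.stub_transferClampRemainder hL hA.2 hC hKI hA.1 hE'))
      (HydroLimitInBandContinuity.stub_windowContinuityInBand hA.1 hA.2 hE')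
      EntropyClockDock.ledgerAprioriBound)

/-! ## §5 Unguarding by dilute self-consistency -/

/-- **Step (3): the guarded Grönwall core and dilute self-consistency give `RelEntropyVanishing` verbatim.** The landed in-band
reduction `EntropyClockDock.relEntropyVanishingInBand_of_gronwallCoreInBand` (activity inversion, reference tie, data pinning, `t = 0`
slice, uniform local Gibbs concentration — all inside) turns the core into the GUARDED Yau target with some `η₀ > 0`; for a tied
classical solution `DiluteSelfConsistency` at `η := η₀` supplies the guard `ρ_t σ³ < η₀` on `[0,T) × 𝕋³` below its own `σ₀'`, so below
`min σ₀ (min σ₀' (1/2))` the guarded target applies; the probability clause (asked before the tie) is `isProbabilityMeasure_localGibbsLaw`.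
[cite: Yau1991, §2] -/
theorem relEntropyVanishing_of_gronwallCoreInBand (hG : GronwallCoreInBand) (hD : DiluteSelfConsistency) :
    RelEntropyVanishing := by
  -- adapted from `EntropyClockDock.relEntropyDock_of_core` (Theorems/TwoClocksClampedWindowDockTimeZero.lean, landed): the guard of the
  -- in-band target is read off `DiluteSelfConsistency` once the flow family and the tie are in hand
  obtain ⟨η₀, hη₀, H⟩ := EntropyClockDock.relEntropyVanishingInBand_of_gronwallCoreInBand hG
  intro a₀ θ₀ u₀ ha hθ hu ha0 hθ0
  obtain ⟨σ₁, hσ₁, H₁⟩ := H a₀ θ₀ u₀ ha hθ hu ha0 hθ0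
  obtain ⟨σ₂, hσ₂, H₂⟩ := hD η₀ hη₀ a₀ θ₀ u₀ ha hθ hu ha0 hθ0
  refine ⟨min σ₁ (min σ₂ (1 / 2)), lt_min hσ₁ (lt_min hσ₂ (by norm_num)), fun σ hσ hσlt T ρ θ u hE Φ => ?_⟩
  have hσ₁' : σ < σ₁ := hσlt.trans_le (min_le_left _ _)
  have hσ₂' : σ < σ₂ := hσlt.trans_le ((min_le_right _ _).trans (min_le_left _ _))
  have hσ2 : σ ≤ 1 / 2 := (hσlt.trans_le ((min_le_right _ _).trans (min_le_right _ _))).le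
  refine ⟨fun N => isProbabilityMeasure_localGibbsLaw ha hθ hu ha0 hθ0 hσ2 N (Φ N), fun htie t ht => ?_⟩
  have hguard : ∀ s ∈ Set.Ico 0 T, ∀ x, ρ s x * σ ^ 3 < η₀ := H₂ σ hσ hσ₂' T ρ θ u hE Φ htie
  exact (H₁ σ hσ hσ₁' T ρ θ u hE hguard Φ).2 htie t ht

/-! ## §6 The registered stub -/

/-- **Registered stub `stub_clockFromInstance` of line `rare-band-ladder-dock` (crux stmt-9282): the clock from the kinetic instance's
output to `RelEntropyVanishing` verbatim** — steps (1)–(3) composed. [cite: Yau1991, §2] -/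
theorem stub_clockFromInstance : ClockFromInstance :=
  fun hKI hL hC hT hE hD => relEntropyVanishing_of_gronwallCoreInBand (gronwallCoreInBand_of_instance hKI hL hC hT hE) hD

end Summit.AtomisticToContinuum.HydrodynamicLimit.Theorems.KineticWindowGronwallClockFromInstance

end
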